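import Literature.AnabelianGeometry.AbsoluteAnabelian.AbsTopIII.Reconstruction
import Literature.AnabelianGeometry.AbsoluteAnabelian.CurveModelFactsNonVacuity
import Literature.AnabelianGeometry.AbsoluteAnabelian.SubpadicExamples
import HarnessLib

/-!
# [AbsTopIII] Thm. 1.9 and Cor. 1.10 (iii) relative to a model: the instance forms are jointly
# satisfiable, non-vacuously, together with the ten §1 / [GalSect] / [AbsCusp] facts

S. Mochizuki, *Topics in Absolute Anabelian Geometry III: global reconstruction algorithms*
[MochizukiAbsTopIII2015], Thm. 1.9 pp. 37–38 ("there exists a functorial 'group-theoretic' algorithm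
for reconstructing the 'NF-portion of the function field' of `X`"), Cor. 1.10 (iii) pp. 43–44
("Reconstruction of the Function Field for MLF's").  Cell abc-iut, block F (fact-proving wave), seat
abc-iut-f-056 (gen 2); PROOF-ONLY companion (no definition, no instance, no `Prop` fact) of
`AbsTopIII/Reconstruction.lean` (abc-iut-L4-t1; imported, never edited) and sequel of
`CurveModelFactsNonVacuity.lean` (p433321).

THE ROWS.  `AbsTopIII.Thm_1_9 M` (FACT-LIST F-0399) and `AbsTopIII.Cor_1_10_iii M` (F-0396) are NAMED
FACTS RELATIVE TO an interface `M : CurveModel` ("SOME functorial group-theoretic algorithm record has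
the printed output on every input curve of the model": `∃ A : NFPortionAlgorithm, ∀ X, M.IsThm19Input X
→ …`, resp. `∃ A : MLFReconstructionAlgorithm, ∀ X, M.IsCor110Input X → M.IsStrictlyBelyiType X → …`).
Their universal closures over ALL `M` are false (`ReconstructionSchemaNegative`, abc-iut-f-088:
`not_forall_thm_1_9`, `not_forall_cor_1_10_iii`, with countermodels whose curves are all Thm-1.9
inputs); the sibling rows Cor. 1.10 (i), (ii) are PROVED at every interface (`cor_1_10_i_holds`,
`cor_1_10_ii_holds`, abc-iut-L4 lineage); the algorithm RECORDS are inhabited by constant algorithms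
(`ReconstructionAlgorithmsNonVacuity`, abc-iut-w5-d053).  This file adds the instance-form side of
F-0399 / F-0396: both comparison clauses are JOINTLY satisfiable at ONE interface, non-vacuously (a
curve flagged of strictly Belyi type over the sub-`p`-adic MLF `ℚ_p`, with a closed point flagged NF),
and SIMULTANEOUSLY with the ten `CurveModel`-relative facts of `CurveModel.facts_of_decomp_eq_top`.

* `exists_reconstructionFacts_nonVacuous` — for every prime `p`: the interface with ONE curve over
  `ℚ_p` (`Π = G_{ℚ_p} = G`, identity augmentation, no cusps, ONE closed point with `D = Π` flagged NF,
  `res = 𝟙`, `K_X := ℚ_p`, `K_{Z_NF} := k̄_NF = ` the algebraic closure of `ℚ` in `ℚ̄_p`, flags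
  strictly-Belyi / proper / scheme all `True`) satisfies `Thm_1_9 M ∧ Cor_1_10_iii M` — by the
  CONSTANT algorithm records sending EVERY extension `E` to the output `k := ℚ_p ⊆ K_X := ℚ_p`, resp.
  `k̄_NF := K_{Z_NF} :=` (the algebraic closure of `ℚ` in `ℚ̄_p`), Kummer container the units with the
  identity Kummer map, point sets `{Π}`, transport / `comap` identities — together with the ten facts
  of p433321, and every binder of the twelve rows fires at the curve.

HONEST LABEL: DEGENERATE / CONSTANT — the algorithm records used here ignore their input and have no
anabelian content; `Δ = 1`; a joint-satisfiability witness about OUR typing of the interface and of the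
comparison clauses (at a ONE-curve interface the comparison clause cannot see functoriality), not a
model of any hyperbolic curve; the printed content (Belyi cuspidalization, Kummer classes, Uchida's
theorem, [pGC] Thm. A) is untouched and stays a named input at the intended étale-`π₁` instance
(abc-iut plan/FOUNDATIONS.md row 12).  FACT-LIST vocabulary: instance forms «model-witnessed (toy)»
for F-0399 / F-0396; nothing is «proved».  Typed ≠ proved; nothing here bears on the disputed
[IUTchIII] Cor. 3.12; no side taken.
-/

noncomputable section

open scoped Classical Pointwise

namespace Literature.AnabelianGeometry.AbsoluteAnabelian.AbsTopIII

open CategoryTheory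

/-- Over an extension, the set "conjugates of `Π`, indexed by a nonempty type with all flags true" is
`{Π}` (the shape of the comparison clauses of Thm. 1.9 (a) / Cor. 1.10 (iii)(e) at the witness).
[cite: MochizukiAbsTopIII2015, Cor 1.10 (iii) p.43] -/
private theorem setOf_conj_top_eq {E : FundamentalExtension.{0}} {ι : Type} [Nonempty ι]
    (P : ι → Prop) (hP : ∀ i, P i) :
    {D : Subgroup E.arith | ∃ (i : ι) (g : E.arith), P i ∧ D = MulAut.conj g • (⊤ : Subgroup E.arith)}
      = {⊤} := by
  have htop : ∀ g : E.arith, MulAut.conj g • (⊤ : Subgroup E.arith) = ⊤ := fun g =>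
    eq_top_iff.mpr fun x _ => by
      rw [Subgroup.mem_pointwise_smul_iff_inv_smul_mem]
      exact Subgroup.mem_top _
  ext D
  simp only [Set.mem_setOf_eq, Set.mem_singleton_iff]
  constructor
  · rintro ⟨i, g, -, rfl⟩
    exact htop g
  · rintro rfl
    obtain ⟨i⟩ := ‹Nonempty ι›
    exact ⟨i, 1, hP i, (htop 1).symm⟩

/-- **JOINT NON-VACUOUS MODEL WITNESS for [AbsTopIII] Thm. 1.9 and Cor. 1.10 (iii) relative to a model
(FACT-LIST F-0399, F-0396 — instance-form side), together with the ten `CurveModel`-relative facts of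
`CurveModel.facts_of_decomp_eq_top`.**  For every prime `p` there is an interface `M : CurveModel`
with closed decomposition data and a curve `X` of `M` such that: `X` is a Thm-1.9 input (strictly
Belyi flag ∧ base field `ℚ_p` sub-`p`-adic) AND a Cor-1.10 input (`ℚ_p` an MLF) of strictly Belyi
flag, proper, scheme-like, with a closed point, all points NF-flagged, no cusps — so every binder of
`Thm_1_9 M` / `Cor_1_10_iii M` fires —, and `Thm_1_9 M ∧ Cor_1_10_iii M` hold (CONSTANT algorithm
records: outputs `k̄_NF = K_{Z_NF} :=` the algebraic closure of `ℚ` in `ℚ̄_p`, resp. `ℚ_p ⊆ ℚ_p`,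
point sets `{Π}`, identity Kummer maps and transports), simultaneously with `Prop_1_4_i`, `Prop_1_4_i'`,
`Prop_1_4_ii`, `Rmk_1_9_2`, `Thm_1_3_ii_model`, `Lem_3_1_model`, `Cor_3_2_model`, `Prop_1_6_iii_model`,
`Thm_2_1_i_model` (every separatedness parameter), `Thm_2_1_i_model_sep`, `Prop_2_2_ii_model`.
(Cor. 1.10 (i), (ii) hold at every interface anyway: `cor_1_10_i_holds`, `cor_1_10_ii_holds`.)
HONEST LABEL: DEGENERATE junk data and constant records (no anabelian content); a statement about
OUR typing, nothing about print. [cite: MochizukiAbsTopIII2015, Thm 1.9 p.37] -/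
theorem exists_reconstructionFacts_nonVacuous (p : ℕ) [Fact p.Prime] :
    ∃ (M : CurveModel.{0})
      (hclosed : ∀ (U : M.Curve) (x : M.Point U), IsClosed (M.decomp U x : Set (M.ext U).arith)),
      (∃ X : M.Curve, M.IsThm19Input X ∧ M.IsCor110Input X ∧ M.IsStrictlyBelyiType X ∧
          M.IsProper X ∧ M.IsScheme X ∧ Nonempty (M.Point X) ∧ (∀ x : M.Point X, M.IsNFPoint X x) ∧
          IsEmpty (M.cusps X).Cusp) ∧
      Thm_1_9 M ∧ Cor_1_10_iii M ∧
      M.Prop_1_4_i ∧ M.Prop_1_4_i' ∧ M.Prop_1_4_ii ∧ M.Rmk_1_9_2 ∧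
      GalSect.Thm_1_3_ii_model M hclosed ∧
      (∀ IsDefinedOverNF : M.Curve → Prop, GalSect.Lem_3_1_model M IsDefinedOverNF hclosed) ∧
      (∀ IsDefinedOverNF IsIsogenousToGenusZero : M.Curve → Prop,
          GalSect.Cor_3_2_model M IsDefinedOverNF IsIsogenousToGenusZero hclosed) ∧
      AbsCusp.Prop_1_6_iii_model M ∧
      (∀ IsSep : M.Curve → Prop, AbsCusp.Thm_2_1_i_model M IsSep hclosed) ∧
      AbsCusp.Thm_2_1_i_model_sep M hclosed ∧
      AbsCusp.Prop_2_2_ii_model M := by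
  -- the point extension `G_{ℚ_p} = G_{ℚ_p}` (identity augmentation, `Δ = 1`)
  let E₀ : FundamentalExtension.{0} :=
    ⟨absoluteGaloisGrp ℚ_[p], absoluteGaloisGrp ℚ_[p], ContinuousMonoidHom.id _, Function.surjective_id⟩
  -- no cusps
  let C₀ : E₀.CuspidalData :=
    { Cusp := PEmpty
      Dcusp := fun c => c.elim
      Icusp := fun c => c.elim
      Icusp_eq := fun c => c.elim
      isClosed_Dcusp := fun c => c.elim
      eq_of_conj := fun c => c.elim }
  -- "`k̄_NF`" of `ℚ_p`: the algebraic closure of `ℚ` in `ℚ̄_p` (= `CurveModel.kbarNF` at the witness)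
  let K₀ : Type := algebraicClosure ℚ (AlgebraicClosure ℚ_[p])
  -- one curve of strictly Belyi flag, one NF-flagged closed point with `D = Π`, `res = 𝟙`,
  -- `K_X := ℚ_p`, `K_{Z_NF} := K₀`
  let M : CurveModel.{0} :=
    { Curve := PUnit
      base := fun _ => ℚ_[p]
      ext := fun _ => E₀
      galIso := fun _ => Iso.refl _
      cusps := fun _ => C₀
      IsProper := fun _ => True
      IsScheme := fun _ => True
      genus := fun _ => 2
      FunctionField := fun _ => ℚ_[p]
      Point := fun _ => PUnit
      decomp := fun _ _ => ⊤
      IsNFCurve := fun _ => True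
      IsNFPoint := fun _ _ => True
      IsNFRational := fun _ _ => False
      IsNFConstant := fun _ _ => False
      NFFunctionField := fun _ => K₀
      IsStrictlyBelyiType := fun _ => True
      IsCofiniteOpen := fun _ _ => True
      res := fun _ => 𝟙 _ }
  have hclosed : ∀ (U : M.Curve) (x : M.Point U), IsClosed (M.decomp U x : Set (M.ext U).arith) :=
    fun U x => by
      show IsClosed ((⊤ : Subgroup E₀.arith) : Set E₀.arith)
      rw [Subgroup.coe_top]
      exact isClosed_univ
  have haug : ∀ U : M.Curve, Function.Injective (M.ext U).aug := fun _ => Function.injective_id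
  have hcusp : ∀ U : M.Curve, IsEmpty (M.cusps U).Cusp := fun _ => ⟨fun c => PEmpty.elim c⟩
  have hsub : IsSubpadic ℚ_[p] := ⟨⟨p, inferInstance, IsSubpadicFor.padic p⟩⟩
  -- the CONSTANT Thm-1.9 algorithm record with output `K₀ ⊆ K₀`, NF-point set `{Π}`
  let A₉ : NFPortionAlgorithm.{0} :=
    { obj := fun E =>
        { nfPointDecomp := {⊤}
          Cover := PUnit
          coverExt := fun _ => E
          coverHom := fun _ => 𝟙 E
          constField := K₀
          functionField := K₀
          H1 := K₀ˣ
          kummer := MonoidHom.id _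
          kummer_injective := fun _ _ h => h }
      map := fun _ => ⟨RingEquiv.refl _, RingEquiv.refl _, fun _ => rfl⟩
      map_id := fun _ => rfl
      map_comp := fun _ _ => rfl
      comap := fun _ _ => RingHom.id _
      comap_map := fun _ _ _ => rfl
      comapBase := fun _ _ => RingHom.id _ }
  -- the CONSTANT Cor-1.10 algorithm record with output `ℚ_p ⊆ ℚ_p`, closed-point set `{Π}`
  let A₁₀ : MLFReconstructionAlgorithm.{0} :=
    { obj := fun E =>
        { galCyclotome := ℤ
          arithCyclotome := ℤ
          cycloSync := AddEquiv.refl ℤ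
          frobQuot := 1
          H1 := (ℚ_[p])ˣ
          baseField := ℚ_[p]
          kummerBase := MonoidHom.id _
          kummerBase_injective := fun _ _ h => h
          functionField := ℚ_[p]
          closedPointDecomp := {⊤} }
      map := fun _ => ⟨RingEquiv.refl _, RingEquiv.refl _, fun _ => rfl⟩
      map_id := fun _ => rfl
      map_comp := fun _ _ => rfl
      comap := fun _ _ => RingHom.id _
      comap_map := fun _ _ _ => rfl }
  refine ⟨M, hclosed, ⟨PUnit.unit, ⟨trivial, hsub⟩, isMLF_padic p, trivial, trivial, trivial,
    ⟨PUnit.unit⟩, fun _ => trivial, hcusp _⟩, ?_, ?_, ?_⟩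
  · -- Thm. 1.9 at the witness, by the constant record `A₉`
    refine ⟨A₉, fun X _ => ⟨?_, ⟨RingEquiv.refl _⟩, ⟨RingEquiv.refl _⟩⟩⟩
    exact (setOf_conj_top_eq (E := E₀) (ι := PUnit) (fun _ => True) fun _ => trivial).symm
  · -- Cor. 1.10 (iii) at the witness, by the constant record `A₁₀`
    refine ⟨A₁₀, fun X _ _ => ⟨⟨RingEquiv.refl _, RingEquiv.refl _, fun _ => rfl⟩, ?_⟩⟩
    have h := setOf_conj_top_eq (E := E₀) (ι := PUnit) (fun _ => True) fun _ => trivial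
    show ({⊤} : Set (Subgroup E₀.arith)) =
      {D | ∃ (x : PUnit) (g : E₀.arith), D = MulAut.conj g • (⊤ : Subgroup E₀.arith)}
    rw [← h]
    ext D
    simp only [Set.mem_setOf_eq, true_and]
  · exact CurveModel.facts_of_decomp_eq_top M hclosed (fun _ _ => rfl) (fun _ => ⟨PUnit.unit⟩)
      (fun _ _ _ => rfl) (fun _ _ => trivial) hcusp haug (fun _ _ _ => Function.injective_id)
      (fun _ _ _ => Function.surjective_id) (fun _ _ _ => Function.bijective_id)

end Literature.AnabelianGeometry.AbsoluteAnabelian.AbsTopIII
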